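import Summits.QuantumFields.YangMills.Theorems.BalabanUVNodesN07FinePathSumLabelled
import Summits.QuantumFields.YangMills.Theorems.BalabanUVNodesN07LandauBondLetter
import HarnessLib

/-!
# N07 [B11] (= [15] = [Balaban1985Variational]) Sect. F, road of record R0′, WIDTH-209 row (r2), FILE 15: **THE ς-DOOR's ONLY SHEAR-SIDE LETTER, END-TO-END BY NAME** —
# on a blow-down tower of boxes the variation of the gauge `u♮` over the fine box (`hvarU`) and of every centred shear `g_j = u♮↾T^{(j)}` over level boxes represented in it (`hvar`)
# follow from: the per-level plaquette letters `a_i` and within-block letters `τ_i` of the axial representative's averages, the top letter `v_k`, and the Landau per-bond letter `θ`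
# (FILE 12 `fineVariation_le_of_runSums` ∘ FILE 14 `sum_dist1_run_le` ∘ FILE 13 `dist1_gaugeAct_le_of_gauge152`)

Cell `pub-ymgap`, width seat `pub-ymgap-dag-n07-w8` g6, WIDTH-209 N07 row (r2) of road R0′, CLAIM-15 ∕ INTENT-15 (cell bus; own lineage FILES 9∕12∕13∕14 → FILE 15).
`--kind proof --supports stmt-QuantumFields-27364 --as helper` (K1⁹ per dag-lead KEY MAP v2); count-neutral; def-free.
[15] = [Balaban1985Variational] (144)–(145) p. 300–301, (151)–(152) p. 301; [6] = [Balaban1985RegularSpaces] (1.15) p. 78, Lemma 1 (1.25) p. 79, (1.131) p. 99;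
[I] = [Balaban1987RG1] (0.1)–(0.3) pp. 251–252; [I.4] = [Balaban1984PropagatorsI] (1.6)–(1.7) p. 18; [3] = [Balaban1985Averaging] (8) p. 19.

THE POINT.  The ς-doors of this lineage (FILE 9 `…_recordShearVariation_dominated_adm22_T4`, FILE 11 `…_cubeDomains_box` and their fine forms) consume ONE letter on the shear side:
`hvar : ∀ j ≤ k, ∀ y ∈ box_j, dist1 (g_j(castSite lo_j)⁻¹·g_j(y)) ≤ ς` (or `hvarU` on a fine set `S` + `hS`).  THIS FILE types its END-TO-END supplier on a BLOW-DOWN TOWER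
`lo i = L·lo(i+1)`, `hi i = L·hi(i+1) + (L−1)` (`i < k`; [6] p. 98's `□̃`-tower is one): (§1) closed forms `lo 0 = Lʲ·lo j`, `hi 0 = Lʲ·hi j + (Lʲ − 1)` and the representative of a
level-`j` box site lies in the fine box (`embIter_coverAt`: label `Lʲz + (Lʲ−1)∕2`); (§2) FILE 12's `hrun` binder on the fine box DISCHARGED by FILE 14's val-free run sum (windows :=
the tower boxes, nested by dag-n07-w6's `nest_blowDown`; run bonds stay in the box by FILE 12 `update_mem_Icc`); (§3) ★ `hvarU` on the fine box with
`ς := 2·Σ_κ (Θ(D_κ) + D_κ·θ)`, `D_κ := (hi 0 κ − lo 0 κ).toNat`, `Θ(m) := m·θ₀ + Σ_{i<k} (m ∕ L^{i+1} + 1)·θ_{i+1}` (dag-n07-w6's layer sum, `θ_i := τ_i + 7((d+2)L)²∕4·a_i + (d+1)(L−1)τ_i`,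
`θ_k := v_k`); (§4) ★ `hvar` for EVERY family of level boxes `castSite '' [lo′ j, hi′ j] ⊆ castSite '' [lo j, hi j]` (FILE 9 §1 `dist1_centredShear_le_of_fineVariation`) — the inclusions are
dag-n07-w6 g2's `castSite_levelBoxes_subset_tildeTower` for the head's canonical boxes inside the `□̃`-tower (cited by name when landed; a hypothesis here); (§5) the Landau letter `θ := 2ξt` from S3's (152)
gauge equation (FILE 13).  What stays DISPLAYED: `a_i`, `τ_i` (or the radial gauge, FILE 14 `sum_dist1_run_radialTower_le`), `v_k`, S3's `(u, A, t)`, the tower.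

WHAT IS PROVED (sorry-free; no definition; axioms standard).
* §1 `lo_zero_eq_of_blowDown` · `hi_zero_eq_of_blowDown` · ★ `embIter_mem_box_zero_of_blowDown` (`y ∈ castSite '' [lo j, hi j]`, `j ≤ k ≤ m + K` ⇒ `embIter j y ∈ castSite '' [lo 0, hi 0]`).
* §2 `layerSum_mono` · ★★ `runSums_of_blowDown` (FILE 12's `hrun` on the fine box of the tower, from FILE 14 `sum_dist1_run_le`).
* §3 ★★★ `fineVariation_le_of_blowDown` (`hvarU` on `castSite '' [lo 0, hi 0]`).
* §4 ★ `centredShearVariation_le_of_fineVariation` (generic: `hvarU` on a fine set `S` + representatives of the boxes `[lo′ j, hi′ j]`, `j ≤ k′`, in `S` ⇒ `hvar`) · ★★★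
  `centredShearVariation_le_of_blowDown_sub` (sub-boxes `castSite '' [lo′ j, hi′ j] ⊆ castSite '' [lo j, hi j]` of the tower, `j ≤ k` — the shape of dag-n07-w6 g2's
  `castSite_levelBoxes_subset_tildeTower`: `hS` DISCHARGED by §1, `hvarU` by §3).
* §5 ★★ `centredShearVariation_le_of_blowDown_sub_gauge152` (∘ FILE 13: `U₁ := U^{u}` the Landau copy of S3's gauge, `θ := 2ξt` on a bond set `B` containing the fine box's bonds, `ξt ≤ 1`).
* A6 `fineVariation_le_of_blowDown_one` (trivial gauge and field: every hypothesis inhabited with `τ = v_k = θ = 0`, any admissible `a₀ > 0`).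
HONEST SCOPE.  Count-neutral by-name composition of LANDED theorems (this base FILES 9∕12∕13∕14; dag-n07-w6 `nest_blowDown`; lit `Node00.TorusCoverLevels.embIter_coverAt`); the letters
`a_i`, `τ_i`, `v_k`, `θ` ∕ S3's `(u, A, t)`, the representative's gauge and the tower are HYPOTHESES ∕ the consumer's; the size of `ς` («uniform in the height», [15] (145)∕(151)) is the
data lane's arithmetic on its letters, NOT typed here; nothing of [15]∕[6]∕[I]∕[I.4]∕[3] ANALYSIS asserted; `LocalLettersSplitTopStepCore(G∕R)` ∕ `DatumGaugeSplitTopStepCore(G∕R)` ∕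
`HalvingStepTop(Core)` ∕ `stub_prop8StepCoP13` NOT discharged; K0⁷ ∕ K1⁹ NOT closed; N07 NOT discharged; counts unmoved (typed 28∕28 · discharged 5∕27); one finite 𝕋⁴ programme at fixed ε —
the route closes the conditional finite-𝕋⁴ rung `BalabanLadder.UV` ONLY; the YM mass gap (Clay) is NOT proved by any of this; nothing continuum ∕ ℝ⁴ ∕ OS.
No `sorry`, no `def`, no `instance`, no `notation`.

RELATED IN THE TREE, NOT DUPLICATED (stem check 2026-08-28T13:41Z: `ls …/Theorems | rg -i 'ShearVariationOfTower|VariationOfTower'` = ∅): FILE 12 `N07FineBoxShearVariation` (the staircase —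
CONSUMED), FILE 14 `N07FinePathSumLabelled` (the run sum — CONSUMED), FILE 13 `N07LandauBondLetter` (`θ` — CONSUMED), FILE 9 `N07SplitClauseOfShearVariation` §1 (`dist1_centredShear_le_of_fineVariation`
— CONSUMED), dag-n07-w6 `N07DataDownTheTowerBlowDown` (`nest_blowDown` — CONSUMED; its `dist1_iter_le_down_the_tower_blowDown` bounds COARSE bond variables, a different output),
dag-n07-w6 g2's announced `N07DataDownTheTowerLevelBoxes` (the `□̃`-tower ⊇ canonical boxes geometry — to be CITED for `hsub`, not restated).
-/

set_option autoImplicit false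

noncomputable section
open scoped BigOperators Matrix.Norms.L2Operator

namespace Summit.QuantumFields.YangMills.BalabanUVNodes.N07ShearVariationOfTower

open Literature.MathematicalPhysics.QuantumFieldTheory.Balaban1983to89
open Literature.MathematicalPhysics.QuantumFieldTheory.Balaban1983to89.Node00
open Literature.MathematicalPhysics.QuantumFieldTheory.Balaban1983to89.B12RegularSpaces111 (gaugeU expI)
open T4Continuum
open T4AxialGaugeSmallField (castSite)
open LatticeFieldCalculus (runSite runBond runSite_succ runSite_zero)
open B15DeterminingSets (embIter)
open B16Sect1Backgrounds (toMS)
open GaugeField (gaugeAct)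
open ExpMeanLog (deltaSU)
open Summit.QuantumFields.YangMills.BalabanUVNodes.N07DataDownTheTowerBlowDown (nest_blowDown)
open Summit.QuantumFields.YangMills.BalabanUVNodes.N07SplitClauseOfShearVariation (dist1_centredShear_le_of_fineVariation)
open Summit.QuantumFields.YangMills.BalabanUVNodes.N07FineBoxShearVariation (runSite_castSite update_mem_Icc fineVariation_le_of_runSums)
open Summit.QuantumFields.YangMills.BalabanUVNodes.N07FinePathSumLabelled (runBond_castSite_src sum_dist1_run_le)
open Summit.QuantumFields.YangMills.BalabanUVNodes.N07LandauBondLetter (dist1_gaugeAct_le_of_gauge152)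

/-! ## §1  Blow-down towers: closed forms and representatives -/

section Tower

variable {P : Params}

/-- Closed form of the lower corners of a blow-down tower: `lo 0 = Lʲ·lo j` for `j ≤ k`. [cite: Balaban1985RegularSpaces, (1.131) p.99 (bookkeeping)] -/
theorem lo_zero_eq_of_blowDown {k : ℕ} (lo : ℕ → Fin P.d → ℤ) (hlo : ∀ j < k, lo j = fun i => (P.L : ℤ) * lo (j + 1) i) :
    ∀ j ≤ k, lo 0 = fun i => (P.L : ℤ) ^ j * lo j i := by
  intro j
  induction j with
  | zero => intro _; funext i; simp
  | succ j ih =>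
    intro hj
    rw [ih (Nat.le_of_succ_le hj)]
    funext i
    rw [hlo j (Nat.lt_of_succ_le hj), pow_succ]
    ring

/-- Closed form of the upper corners of a blow-down tower: `hi 0 = Lʲ·hi j + (Lʲ − 1)` for `j ≤ k`. [cite: Balaban1985RegularSpaces, (1.131) p.99 (bookkeeping)] -/
theorem hi_zero_eq_of_blowDown {k : ℕ} (hi : ℕ → Fin P.d → ℤ) (hhi : ∀ j < k, hi j = fun i => (P.L : ℤ) * hi (j + 1) i + ((P.L : ℤ) - 1)) :
    ∀ j ≤ k, hi 0 = fun i => (P.L : ℤ) ^ j * hi j i + ((P.L : ℤ) ^ j - 1) := by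
  intro j
  induction j with
  | zero => intro _; funext i; simp
  | succ j ih =>
    intro hj
    rw [ih (Nat.le_of_succ_le hj)]
    funext i
    rw [hhi j (Nat.lt_of_succ_le hj), pow_succ]
    ring

/-- ★ **THE REPRESENTATIVE OF A LEVEL-`j` BOX SITE LIES IN THE FINE BOX OF THE TOWER**: for `j ≤ k ≤ m + K` and `y ∈ castSite '' [lo j, hi j]`, `embIter j y ∈ castSite '' [lo 0, hi 0]` — the
representative of `castSite z` has label `Lʲz + (Lʲ − 1)∕2` (lit `embIter_coverAt`), and `Lʲ·lo j ≤ Lʲz + (Lʲ−1)∕2 ≤ Lʲ·hi j + (Lʲ − 1)`.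
[cite: Balaban1987RG1, (0.1) p.251; Balaban1985RegularSpaces, (1.131) p.99] -/
theorem embIter_mem_box_zero_of_blowDown {k : ℕ} (hk : k ≤ P.m + P.K) (lo hi : ℕ → Fin P.d → ℤ)
    (hlo : ∀ j < k, lo j = fun i => (P.L : ℤ) * lo (j + 1) i) (hhi : ∀ j < k, hi j = fun i => (P.L : ℤ) * hi (j + 1) i + ((P.L : ℤ) - 1))
    {j : ℕ} (hj : j ≤ k) {y : Site P j} (hy : y ∈ (castSite '' Set.Icc (lo j) (hi j) : Set (Site P j))) :
    embIter j y ∈ (castSite '' Set.Icc (lo 0) (hi 0) : Set (Site P 0)) := by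
  obtain ⟨z, ⟨hzlo, hzhi⟩, rfl⟩ := hy
  have hrep : embIter j (castSite z : Site P j) = castSite (fun μ => (P.L : ℤ) ^ j * z μ + ((P.L ^ j - 1) / 2 : ℕ)) := by
    show embIter j (coverAt P j z) = _
    rw [embIter_coverAt (hk.trans' hj) z]
    rfl
  rw [hrep, lo_zero_eq_of_blowDown lo hlo j hj, hi_zero_eq_of_blowDown hi hhi j hj]
  have hLj : (1 : ℤ) ≤ (P.L : ℤ) ^ j := by exact_mod_cast Nat.one_le_pow _ _ P.L_pos
  have hc0 : (0 : ℤ) ≤ ((P.L ^ j - 1) / 2 : ℕ) := by positivity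
  have hc1 : (((P.L ^ j - 1) / 2 : ℕ) : ℤ) ≤ (P.L : ℤ) ^ j - 1 := by
    have h1 : (P.L ^ j - 1) / 2 ≤ P.L ^ j - 1 := Nat.div_le_self _ _
    have h2 : 1 ≤ P.L ^ j := Nat.one_le_pow _ _ P.L_pos
    have h3 : (((P.L ^ j - 1 : ℕ)) : ℤ) = (P.L : ℤ) ^ j - 1 := by push_cast [Nat.cast_sub h2]; ring
    rw [← h3]; exact_mod_cast h1
  refine ⟨_, ⟨fun i => ?_, fun i => ?_⟩, rfl⟩
  · have h := hzlo i
    simp only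
    nlinarith
  · have h := hzhi i
    simp only
    nlinarith

end Tower

/-! ## §2  FILE 12's run sums on the fine box of a blow-down tower -/

section Runs

variable {F : T4Continuum.T4Family} {N : ℕ} [NeZero N] {K : ℕ}

/-- The layer sum is monotone in the run length (`m ∕ L^{i+1}` is monotone, letters non-negative). [folklore] -/
theorem layerSum_mono {L k : ℕ} {θ₀ : ℝ} (g : ℕ → ℝ) (hθ₀ : 0 ≤ θ₀) (hg : ∀ i < k, 0 ≤ g i) :
    Monotone (fun m : ℕ => (m : ℝ) * θ₀ + ∑ i ∈ Finset.range k, (((m / L ^ (i + 1) + 1 : ℕ)) : ℝ) * g i) := by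
  intro m m' hmm'
  refine add_le_add (mul_le_mul_of_nonneg_right (by exact_mod_cast hmm') hθ₀) (Finset.sum_le_sum fun i hi => ?_)
  refine mul_le_mul_of_nonneg_right ?_ (hg i (Finset.mem_range.1 hi))
  exact_mod_cast Nat.add_le_add_right (Nat.div_le_div_right hmm') 1

/-- ★★ **FILE 12's `hrun` BINDER ON THE FINE BOX OF A BLOW-DOWN TOWER, DISCHARGED**: any representative `U′`, tower `lo∕hi` of height `1 ≤ k ≤ m + K`, per-level letters `a_i, τ_i ≥ 0` with
`((d+2)L)²∕4·a_i < δ_N`, plaquette ∕ within-block hypotheses on the tower boxes, top letter `v_k` on the top box; then every straight run inside the integer box `[lo 0, hi 0]` has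
`Σ_{s<m} dist1 U′(runBond (castSite z) μ s) ≤ Θ(m)` (FILE 14 `sum_dist1_run_le`, windows := the tower boxes nested by `nest_blowDown`, run bonds in the box by FILE 12 `update_mem_Icc`).
[cite: Balaban1985Variational, (144)–(145) pp.300–301; Balaban1985RegularSpaces, Lemma 1 (1.25) p.79, (1.131) p.99; Balaban1984PropagatorsI, (1.7) p.18] -/
theorem runSums_of_blowDown {k : ℕ} (hk1 : 1 ≤ k) (hk : k ≤ (F.P K).m + (F.P K).K) (U' : GaugeField (F.P K) 0 (SU N)) (lo hi : ℕ → Fin (F.P K).d → ℤ)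
    (hlo : ∀ j < k, lo j = fun i => ((F.P K).L : ℤ) * lo (j + 1) i) (hhi : ∀ j < k, hi j = fun i => ((F.P K).L : ℤ) * hi (j + 1) i + (((F.P K).L : ℤ) - 1))
    (a τ : ℕ → ℝ) {vk : ℝ} (ha : ∀ i < k, 0 ≤ a i) (hτ : ∀ i < k, 0 ≤ τ i) (hvk : 0 ≤ vk)
    (ht : ∀ i < k, (((((F.P K).d + 2) * (F.P K).L : ℕ) : ℝ) ^ 2 / 4) * a i < deltaSU (Fin N))
    (hplaq : ∀ i < k, ∀ c : PBond (F.P K) (i + 1), c.src ∈ (castSite '' Set.Icc (lo (i + 1)) (hi (i + 1)) : Set (Site (F.P K) (i + 1))) →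
      c.tgt ∈ (castSite '' Set.Icc (lo (i + 1)) (hi (i + 1)) : Set (Site (F.P K) (i + 1))) → ∀ q : Plaq (F.P K) i,
      (blockOf q.src = c.src.unshift c.dir ∨ blockOf q.src = c.src ∨ blockOf q.src = c.tgt) → dist1 (GaugeField.plaqHol (Averaging.iter (avOfRecord F N K) i U') q) < a i)
    (hint : ∀ i < k, ∀ b' : PBond (F.P K) i, blockOf b'.src = blockOf b'.tgt →
      blockOf b'.src ∈ (castSite '' Set.Icc (lo (i + 1)) (hi (i + 1)) : Set (Site (F.P K) (i + 1))) → dist1 (Averaging.iter (avOfRecord F N K) i U' b') ≤ τ i)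
    (htop : ∀ c : PBond (F.P K) k, c.src ∈ (castSite '' Set.Icc (lo k) (hi k) : Set (Site (F.P K) k)) → c.tgt ∈ (castSite '' Set.Icc (lo k) (hi k) : Set (Site (F.P K) k)) →
      dist1 (Averaging.iter (avOfRecord F N K) k U' c) ≤ vk) :
    ∀ (z : Fin (F.P K).d → ℤ) (μ : Fin (F.P K).d) (m : ℕ), lo 0 ≤ z → Function.update z μ (z μ + m) ≤ hi 0 →
      ∑ s ∈ Finset.range m, dist1 (U' (runBond (castSite z : Site (F.P K) 0) μ s)) ≤
        (m : ℝ) * (τ 0 + (7 * ((((((F.P K).d + 2) * (F.P K).L : ℕ) : ℝ) ^ 2 / 4) * a 0) + ((((F.P K).d + 1) * ((F.P K).L - 1) : ℕ) : ℝ) * τ 0)) +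
          ∑ i ∈ Finset.range k, (((m / (F.P K).L ^ (i + 1) + 1 : ℕ)) : ℝ) *
            (if i + 1 < k then τ (i + 1) + (7 * ((((((F.P K).d + 2) * (F.P K).L : ℕ) : ℝ) ^ 2 / 4) * a (i + 1)) + ((((F.P K).d + 1) * ((F.P K).L - 1) : ℕ) : ℝ) * τ (i + 1))
              else vk) := by
  intro z μ m hzlo hend
  have hzhi : z ≤ hi 0 := fun κ => by
    have h := hend κ
    rw [Function.update_apply] at h
    split_ifs at h with hκ
    · subst hκ
      have h0 : (0 : ℤ) ≤ (m : ℤ) := Int.natCast_nonneg m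
      linarith
    · exact h
  have hendμ : z μ + m ≤ hi 0 μ := by have h := hend μ; rwa [Function.update_self] at h
  refine sum_dist1_run_le hk1 hk U' (fun i => (castSite '' Set.Icc (lo i) (hi i) : Set (Site (F.P K) i))) a τ (nest_blowDown hk lo hi hlo hhi)
    ha hτ hvk ht hplaq hint htop z μ m fun s hs => ⟨?_, ?_⟩
  · -- near end of the `s`-th run bond
    rw [(runBond_castSite_src (F := F) (K := K) z μ s).2]
    obtain ⟨h1, h2⟩ := update_mem_Icc hzlo hzhi hendμ hs.le
    exact ⟨_, ⟨h1, h2⟩, rfl⟩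
  · -- far end of the `s`-th run bond
    have e3 : (runBond (castSite z : Site (F.P K) 0) μ s).tgt = castSite (Function.update z μ (z μ + ((s + 1 : ℕ) : ℤ))) := by
      show (runSite (castSite z) μ s).shift μ = _
      rw [← runSite_succ, runSite_castSite]
    rw [e3]
    obtain ⟨h1, h2⟩ := update_mem_Icc hzlo hzhi hendμ (Nat.succ_le_of_lt hs)
    exact ⟨_, ⟨h1, h2⟩, rfl⟩

end Runs

/-! ## §3  The variation letter `hvarU` on the fine box of the tower -/

section FineBox

variable {F : T4Continuum.T4Family} {N : ℕ} [NeZero N] {K : ℕ}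

/-- ★★★ **`hvarU` ON THE FINE BOX OF A BLOW-DOWN TOWER**: gauge `u` (the shear gauge `u♮`), Landau copy `U₁`, representative `U′ := U₁^{u}`; tower `lo∕hi` of height `1 ≤ k ≤ m + K`; per-level
letters `a_i, τ_i` of the averages `Mⁱ U′` on the tower boxes, top letter `v_k`, Landau per-bond letter `0 ≤ θ` on the bonds of the fine box `castSite '' [lo 0, hi 0]`.  Then for all `x, x′`
in the fine box: `dist1 (u(x)⁻¹·u(x′)) ≤ 2·Σ_κ (Θ(D_κ) + D_κ·θ)`, `D_κ := (hi 0 κ − lo 0 κ).toNat`, `Θ` = the layer sum (FILE 12 `fineVariation_le_of_runSums` ∘ §2).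
[cite: Balaban1985Variational, (144)–(145) pp.300–301, (151)–(152) p.301; Balaban1985RegularSpaces, Lemma 1 (1.25) p.79; Balaban1985Averaging, (8) p.19; Balaban1984PropagatorsI, (1.7) p.18] -/
theorem fineVariation_le_of_blowDown {k : ℕ} (hk1 : 1 ≤ k) (hk : k ≤ (F.P K).m + (F.P K).K) (u : GaugeTransf (F.P K) 0 (SU N)) (U₁ : GaugeField (F.P K) 0 (SU N))
    (lo hi : ℕ → Fin (F.P K).d → ℤ)
    (hlo : ∀ j < k, lo j = fun i => ((F.P K).L : ℤ) * lo (j + 1) i) (hhi : ∀ j < k, hi j = fun i => ((F.P K).L : ℤ) * hi (j + 1) i + (((F.P K).L : ℤ) - 1))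
    (a τ : ℕ → ℝ) {vk θ : ℝ} (ha : ∀ i < k, 0 ≤ a i) (hτ : ∀ i < k, 0 ≤ τ i) (hvk : 0 ≤ vk) (hθ : 0 ≤ θ)
    (ht : ∀ i < k, (((((F.P K).d + 2) * (F.P K).L : ℕ) : ℝ) ^ 2 / 4) * a i < deltaSU (Fin N))
    (hplaq : ∀ i < k, ∀ c : PBond (F.P K) (i + 1), c.src ∈ (castSite '' Set.Icc (lo (i + 1)) (hi (i + 1)) : Set (Site (F.P K) (i + 1))) →
      c.tgt ∈ (castSite '' Set.Icc (lo (i + 1)) (hi (i + 1)) : Set (Site (F.P K) (i + 1))) → ∀ q : Plaq (F.P K) i,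
      (blockOf q.src = c.src.unshift c.dir ∨ blockOf q.src = c.src ∨ blockOf q.src = c.tgt) →
      dist1 (GaugeField.plaqHol (Averaging.iter (avOfRecord F N K) i (gaugeAct u U₁)) q) < a i)
    (hint : ∀ i < k, ∀ b' : PBond (F.P K) i, blockOf b'.src = blockOf b'.tgt →
      blockOf b'.src ∈ (castSite '' Set.Icc (lo (i + 1)) (hi (i + 1)) : Set (Site (F.P K) (i + 1))) → dist1 (Averaging.iter (avOfRecord F N K) i (gaugeAct u U₁) b') ≤ τ i)
    (htop : ∀ c : PBond (F.P K) k, c.src ∈ (castSite '' Set.Icc (lo k) (hi k) : Set (Site (F.P K) k)) → c.tgt ∈ (castSite '' Set.Icc (lo k) (hi k) : Set (Site (F.P K) k)) →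
      dist1 (Averaging.iter (avOfRecord F N K) k (gaugeAct u U₁) c) ≤ vk)
    (hU₁ : ∀ b : PBond (F.P K) 0, b.src ∈ (castSite '' Set.Icc (lo 0) (hi 0) : Set (Site (F.P K) 0)) → b.tgt ∈ (castSite '' Set.Icc (lo 0) (hi 0) : Set (Site (F.P K) 0)) →
      dist1 (U₁ b) ≤ θ) :
    ∀ x ∈ (castSite '' Set.Icc (lo 0) (hi 0) : Set (Site (F.P K) 0)), ∀ x' ∈ (castSite '' Set.Icc (lo 0) (hi 0) : Set (Site (F.P K) 0)),
      dist1 ((u x)⁻¹ * u x') ≤ 2 * ∑ κ, (((((hi 0 κ - lo 0 κ).toNat : ℕ) : ℝ) * (τ 0 + (7 * ((((((F.P K).d + 2) * (F.P K).L : ℕ) : ℝ) ^ 2 / 4) * a 0) +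
          ((((F.P K).d + 1) * ((F.P K).L - 1) : ℕ) : ℝ) * τ 0)) +
        ∑ i ∈ Finset.range k, ((((hi 0 κ - lo 0 κ).toNat / (F.P K).L ^ (i + 1) + 1 : ℕ)) : ℝ) *
          (if i + 1 < k then τ (i + 1) + (7 * ((((((F.P K).d + 2) * (F.P K).L : ℕ) : ℝ) ^ 2 / 4) * a (i + 1)) + ((((F.P K).d + 1) * ((F.P K).L - 1) : ℕ) : ℝ) * τ (i + 1))
            else vk)) + (((hi 0 κ - lo 0 κ).toNat : ℕ) : ℝ) * θ) := by
  have hκ : ∀ i < k, 0 ≤ (if i + 1 < k then τ (i + 1) + (7 * ((((((F.P K).d + 2) * (F.P K).L : ℕ) : ℝ) ^ 2 / 4) * a (i + 1)) +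
      ((((F.P K).d + 1) * ((F.P K).L - 1) : ℕ) : ℝ) * τ (i + 1)) else vk) := by
    intro i hi
    split_ifs with h
    · have := ha (i + 1) h; have := hτ (i + 1) h; positivity
    · exact hvk
  have hθ0 : 0 ≤ τ 0 + (7 * ((((((F.P K).d + 2) * (F.P K).L : ℕ) : ℝ) ^ 2 / 4) * a 0) + ((((F.P K).d + 1) * ((F.P K).L - 1) : ℕ) : ℝ) * τ 0) := by
    have := ha 0 (by omega); have := hτ 0 (by omega); positivity
  exact fineVariation_le_of_runSums u U₁ (fun _ m => (m : ℝ) * (τ 0 + (7 * ((((((F.P K).d + 2) * (F.P K).L : ℕ) : ℝ) ^ 2 / 4) * a 0) +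
      ((((F.P K).d + 1) * ((F.P K).L - 1) : ℕ) : ℝ) * τ 0)) + ∑ i ∈ Finset.range k, (((m / (F.P K).L ^ (i + 1) + 1 : ℕ)) : ℝ) *
        (if i + 1 < k then τ (i + 1) + (7 * ((((((F.P K).d + 2) * (F.P K).L : ℕ) : ℝ) ^ 2 / 4) * a (i + 1)) + ((((F.P K).d + 1) * ((F.P K).L - 1) : ℕ) : ℝ) * τ (i + 1))
          else vk)) hθ (fun _ => layerSum_mono (fun i => if i + 1 < k then τ (i + 1) + (7 * ((((((F.P K).d + 2) * (F.P K).L : ℕ) : ℝ) ^ 2 / 4) * a (i + 1)) +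
      ((((F.P K).d + 1) * ((F.P K).L - 1) : ℕ) : ℝ) * τ (i + 1)) else vk) hθ0 hκ)
    (runSums_of_blowDown hk1 hk (gaugeAct u U₁) lo hi hlo hhi a τ ha hτ hvk ht hplaq hint htop) hU₁

end FineBox

/-! ## §4  The ς-door's `hvar`: centred shears over represented level boxes -/

section Shear

variable {F : T4Continuum.T4Family} {N : ℕ} [NeZero N] {K : ℕ}

/-- ★★★ **THE ς-DOOR's `hvar` FROM `hvarU`** (generic, FILE 9 §1 `dist1_centredShear_le_of_fineVariation`): if the fine gauge's variation over a fine set `S` is `≤ ς` and the representatives of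
the level boxes `castSite '' [lo′ j, hi′ j]`, `j ≤ k′`, lie in `S`, then `dist1 (g_j(castSite lo′_j)⁻¹·g_j(y)) ≤ ς` on every such box (`g_j := u↾T^{(j)}`; the corner is a box site as soon
as the box meets a site). [cite: Balaban1985Variational, (151)–(152) p.301; Balaban1987RG1, (0.1) p.251] -/
theorem centredShearVariation_le_of_fineVariation (u : GaugeTransf (F.P K) 0 (SU N)) {S : Set (Site (F.P K) 0)} {ς : ℝ}
    (hvarU : ∀ x ∈ S, ∀ x' ∈ S, dist1 ((u x)⁻¹ * u x') ≤ ς) {k' : ℕ} (lo' hi' : ℕ → Fin (F.P K).d → ℤ)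
    (hS : ∀ j ≤ k', ∀ y : Site (F.P K) j, y ∈ (castSite '' Set.Icc (lo' j) (hi' j) : Set (Site (F.P K) j)) → embIter j y ∈ S) :
    ∀ j ≤ k', ∀ y : Site (F.P K) j, y ∈ (castSite '' Set.Icc (lo' j) (hi' j) : Set (Site (F.P K) j)) →
      dist1 ((toMS u j (castSite (lo' j)))⁻¹ * toMS u j y) ≤ ς := by
  intro j hj y hy
  have hlo : (castSite (lo' j) : Site (F.P K) j) ∈ (castSite '' Set.Icc (lo' j) (hi' j) : Set (Site (F.P K) j)) := by
    obtain ⟨z, hz, -⟩ := hy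
    exact ⟨lo' j, ⟨le_rfl, hz.1.trans hz.2⟩, rfl⟩
  exact dist1_centredShear_le_of_fineVariation u hvarU (hS j hj _ hlo) (hS j hj y hy)

/-- ★★★ **THE ς-DOOR's `hvar` ON SUB-BOXES OF A BLOW-DOWN TOWER, END-TO-END**: in the setting of `fineVariation_le_of_blowDown`, for every family of level boxes with
`castSite '' [lo′ j, hi′ j] ⊆ castSite '' [lo j, hi j]` (`j ≤ k`; for the head's canonical boxes inside the `□̃`-tower these inclusions are dag-n07-w6 g2's `castSite_levelBoxes_subset_tildeTower`):
`∀ j ≤ k, ∀ y ∈ castSite '' [lo′ j, hi′ j], dist1 (g_j(castSite lo′_j)⁻¹·g_j(y)) ≤ 2·Σ_κ (Θ(D_κ) + D_κ·θ)` — the ONLY shear-side letter of FILES 9∕11's ς-doors, supplied from the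
letters `a_i`, `τ_i`, `v_k`, `θ`. [cite: Balaban1985Variational, (144)–(145) pp.300–301, (151)–(152) p.301; Balaban1985RegularSpaces, Lemma 1 (1.25) p.79, (1.131) p.99; Balaban1987RG1, (0.1) p.251] -/
theorem centredShearVariation_le_of_blowDown_sub {k : ℕ} (hk1 : 1 ≤ k) (hk : k ≤ (F.P K).m + (F.P K).K) (u : GaugeTransf (F.P K) 0 (SU N)) (U₁ : GaugeField (F.P K) 0 (SU N))
    (lo hi : ℕ → Fin (F.P K).d → ℤ)
    (hlo : ∀ j < k, lo j = fun i => ((F.P K).L : ℤ) * lo (j + 1) i) (hhi : ∀ j < k, hi j = fun i => ((F.P K).L : ℤ) * hi (j + 1) i + (((F.P K).L : ℤ) - 1))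
    (a τ : ℕ → ℝ) {vk θ : ℝ} (ha : ∀ i < k, 0 ≤ a i) (hτ : ∀ i < k, 0 ≤ τ i) (hvk : 0 ≤ vk) (hθ : 0 ≤ θ)
    (ht : ∀ i < k, (((((F.P K).d + 2) * (F.P K).L : ℕ) : ℝ) ^ 2 / 4) * a i < deltaSU (Fin N))
    (hplaq : ∀ i < k, ∀ c : PBond (F.P K) (i + 1), c.src ∈ (castSite '' Set.Icc (lo (i + 1)) (hi (i + 1)) : Set (Site (F.P K) (i + 1))) →
      c.tgt ∈ (castSite '' Set.Icc (lo (i + 1)) (hi (i + 1)) : Set (Site (F.P K) (i + 1))) → ∀ q : Plaq (F.P K) i,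
      (blockOf q.src = c.src.unshift c.dir ∨ blockOf q.src = c.src ∨ blockOf q.src = c.tgt) →
      dist1 (GaugeField.plaqHol (Averaging.iter (avOfRecord F N K) i (gaugeAct u U₁)) q) < a i)
    (hint : ∀ i < k, ∀ b' : PBond (F.P K) i, blockOf b'.src = blockOf b'.tgt →
      blockOf b'.src ∈ (castSite '' Set.Icc (lo (i + 1)) (hi (i + 1)) : Set (Site (F.P K) (i + 1))) → dist1 (Averaging.iter (avOfRecord F N K) i (gaugeAct u U₁) b') ≤ τ i)
    (htop : ∀ c : PBond (F.P K) k, c.src ∈ (castSite '' Set.Icc (lo k) (hi k) : Set (Site (F.P K) k)) → c.tgt ∈ (castSite '' Set.Icc (lo k) (hi k) : Set (Site (F.P K) k)) →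
      dist1 (Averaging.iter (avOfRecord F N K) k (gaugeAct u U₁) c) ≤ vk)
    (hU₁ : ∀ b : PBond (F.P K) 0, b.src ∈ (castSite '' Set.Icc (lo 0) (hi 0) : Set (Site (F.P K) 0)) → b.tgt ∈ (castSite '' Set.Icc (lo 0) (hi 0) : Set (Site (F.P K) 0)) →
      dist1 (U₁ b) ≤ θ)
    (lo' hi' : ℕ → Fin (F.P K).d → ℤ)
    (hsub : ∀ j ≤ k, (castSite '' Set.Icc (lo' j) (hi' j) : Set (Site (F.P K) j)) ⊆ castSite '' Set.Icc (lo j) (hi j)) :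
    ∀ j ≤ k, ∀ y : Site (F.P K) j, y ∈ (castSite '' Set.Icc (lo' j) (hi' j) : Set (Site (F.P K) j)) →
      dist1 ((toMS u j (castSite (lo' j)))⁻¹ * toMS u j y) ≤ 2 * ∑ κ, (((((hi 0 κ - lo 0 κ).toNat : ℕ) : ℝ) * (τ 0 + (7 * ((((((F.P K).d + 2) * (F.P K).L : ℕ) : ℝ) ^ 2 / 4) * a 0) +
          ((((F.P K).d + 1) * ((F.P K).L - 1) : ℕ) : ℝ) * τ 0)) +
        ∑ i ∈ Finset.range k, ((((hi 0 κ - lo 0 κ).toNat / (F.P K).L ^ (i + 1) + 1 : ℕ)) : ℝ) *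
          (if i + 1 < k then τ (i + 1) + (7 * ((((((F.P K).d + 2) * (F.P K).L : ℕ) : ℝ) ^ 2 / 4) * a (i + 1)) + ((((F.P K).d + 1) * ((F.P K).L - 1) : ℕ) : ℝ) * τ (i + 1))
            else vk)) + (((hi 0 κ - lo 0 κ).toNat : ℕ) : ℝ) * θ) :=
  centredShearVariation_le_of_fineVariation u (fineVariation_le_of_blowDown hk1 hk u U₁ lo hi hlo hhi a τ ha hτ hvk hθ ht hplaq hint htop hU₁) lo' hi'
    fun j hj _ hy => embIter_mem_box_zero_of_blowDown hk lo hi hlo hhi hj (hsub j hj hy)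

end Shear

/-! ## §5  With the Landau per-bond letter from S3's (152) gauge equation -/

section Gauge152

variable {F : T4Continuum.T4Family} {N : ℕ} [NeZero N] {K : ℕ}

/-- ★★ **END-TO-END WITH S3's LETTER**: in §4's setting take `U₁ := U^{w}` the Landau copy of S3's gauge `w` of `U` — on a bond set `B` containing every bond of the fine box, the (152)
gauge equation `(ι∘U)^{ι∘w}(b) = e^{iξA(b)}` with `‖A(b)‖ < t`, `0 ≤ ξ`, `ξt ≤ 1` (FILE 13: `θ := 2ξt`).  Then the ς-door's `hvar` holds on every sub-box family of the tower with
`ς := 2·Σ_κ (Θ(D_κ) + D_κ·2ξt)` — DISPLAYED letters: `a_i`, `τ_i`, `v_k` of the averages of the representative `(U^{w})^{u}`, and S3's `t`.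
[cite: Balaban1985Variational, (144)–(145) pp.300–301, (151)–(152) p.301; Balaban1985RegularSpaces, Thm 2, Lemma 1 (1.25) p.79; Balaban1987RG1, (1.13) p.262] -/
theorem centredShearVariation_le_of_blowDown_sub_gauge152 {k : ℕ} (hk1 : 1 ≤ k) (hk : k ≤ (F.P K).m + (F.P K).K) (u w : GaugeTransf (F.P K) 0 (SU N)) (U : GaugeField (F.P K) 0 (SU N))
    (lo hi : ℕ → Fin (F.P K).d → ℤ)
    (hlo : ∀ j < k, lo j = fun i => ((F.P K).L : ℤ) * lo (j + 1) i) (hhi : ∀ j < k, hi j = fun i => ((F.P K).L : ℤ) * hi (j + 1) i + (((F.P K).L : ℤ) - 1))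
    (a τ : ℕ → ℝ) {vk : ℝ} (ha : ∀ i < k, 0 ≤ a i) (hτ : ∀ i < k, 0 ≤ τ i) (hvk : 0 ≤ vk)
    (ht : ∀ i < k, (((((F.P K).d + 2) * (F.P K).L : ℕ) : ℝ) ^ 2 / 4) * a i < deltaSU (Fin N))
    (hplaq : ∀ i < k, ∀ c : PBond (F.P K) (i + 1), c.src ∈ (castSite '' Set.Icc (lo (i + 1)) (hi (i + 1)) : Set (Site (F.P K) (i + 1))) →
      c.tgt ∈ (castSite '' Set.Icc (lo (i + 1)) (hi (i + 1)) : Set (Site (F.P K) (i + 1))) → ∀ q : Plaq (F.P K) i,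
      (blockOf q.src = c.src.unshift c.dir ∨ blockOf q.src = c.src ∨ blockOf q.src = c.tgt) →
      dist1 (GaugeField.plaqHol (Averaging.iter (avOfRecord F N K) i (gaugeAct u (gaugeAct w U))) q) < a i)
    (hint : ∀ i < k, ∀ b' : PBond (F.P K) i, blockOf b'.src = blockOf b'.tgt →
      blockOf b'.src ∈ (castSite '' Set.Icc (lo (i + 1)) (hi (i + 1)) : Set (Site (F.P K) (i + 1))) → dist1 (Averaging.iter (avOfRecord F N K) i (gaugeAct u (gaugeAct w U)) b') ≤ τ i)
    (htop : ∀ c : PBond (F.P K) k, c.src ∈ (castSite '' Set.Icc (lo k) (hi k) : Set (Site (F.P K) k)) → c.tgt ∈ (castSite '' Set.Icc (lo k) (hi k) : Set (Site (F.P K) k)) →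
      dist1 (Averaging.iter (avOfRecord F N K) k (gaugeAct u (gaugeAct w U)) c) ≤ vk)
    -- S3's (152) gauge equation and letter on a bond set containing the fine box's bonds
    {ξ t : ℝ} (hξ : 0 ≤ ξ) (ht0 : 0 ≤ t) (hξt : ξ * t ≤ 1) {A : PBond (F.P K) 0 → MatA N} {B : Set (PBond (F.P K) 0)}
    (he : ∀ b ∈ B, gaugeU (fun x => ιSU N (w x)) (fun b' => ιSU N (U b')) b = expI ξ (A b)) (hA : ∀ b ∈ B, ‖A b‖ < t)
    (hB : ∀ b : PBond (F.P K) 0, b.src ∈ (castSite '' Set.Icc (lo 0) (hi 0) : Set (Site (F.P K) 0)) → b.tgt ∈ (castSite '' Set.Icc (lo 0) (hi 0) : Set (Site (F.P K) 0)) → b ∈ B)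
    (lo' hi' : ℕ → Fin (F.P K).d → ℤ)
    (hsub : ∀ j ≤ k, (castSite '' Set.Icc (lo' j) (hi' j) : Set (Site (F.P K) j)) ⊆ castSite '' Set.Icc (lo j) (hi j)) :
    ∀ j ≤ k, ∀ y : Site (F.P K) j, y ∈ (castSite '' Set.Icc (lo' j) (hi' j) : Set (Site (F.P K) j)) →
      dist1 ((toMS u j (castSite (lo' j)))⁻¹ * toMS u j y) ≤ 2 * ∑ κ, (((((hi 0 κ - lo 0 κ).toNat : ℕ) : ℝ) * (τ 0 + (7 * ((((((F.P K).d + 2) * (F.P K).L : ℕ) : ℝ) ^ 2 / 4) * a 0) +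
          ((((F.P K).d + 1) * ((F.P K).L - 1) : ℕ) : ℝ) * τ 0)) +
        ∑ i ∈ Finset.range k, ((((hi 0 κ - lo 0 κ).toNat / (F.P K).L ^ (i + 1) + 1 : ℕ)) : ℝ) *
          (if i + 1 < k then τ (i + 1) + (7 * ((((((F.P K).d + 2) * (F.P K).L : ℕ) : ℝ) ^ 2 / 4) * a (i + 1)) + ((((F.P K).d + 1) * ((F.P K).L - 1) : ℕ) : ℝ) * τ (i + 1))
            else vk)) + (((hi 0 κ - lo 0 κ).toNat : ℕ) : ℝ) * (2 * (ξ * t))) := by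
  have hθ : (0 : ℝ) ≤ 2 * (ξ * t) := by positivity
  exact centredShearVariation_le_of_blowDown_sub hk1 hk u (gaugeAct w U) lo hi hlo hhi a τ ha hτ hvk hθ ht hplaq hint htop
    (fun b hs htg => dist1_gaugeAct_le_of_gauge152 N w U hξ hξt he hA b (hB b hs htg)) lo' hi' hsub

end Gauge152

/-! ## A6  Non-vacuity -/

section NonVacuity

variable {F : T4Continuum.T4Family} {N : ℕ} [NeZero N] {K : ℕ}

/-- A6 NON-VACUITY of §3: at the trivial gauge `u = 1` and Landau copy `U₁ = 1` (representative `1^{1} = 1`, averages `Mⁱ(1) = 1`: lit `B12RTGaugeInvariance254.gaugeAct_one'`,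
`B15Claim189UnitTestAtRecord.iter_avOfRecord_one`) every hypothesis of `fineVariation_le_of_blowDown` holds on ANY blow-down tower with `τ = 0`, `v_k = 0`, `θ = 0` and any plaquette letter
`a₀ > 0` below the [6] Lemma 1 threshold (dag-n07-w6 `plaq_down_the_tower_one`), and the conclusion bounds `dist1 (1⁻¹·1) = 0`. [cite: Balaban1985Variational, (152) p.301 (bookkeeping)] -/
theorem fineVariation_le_of_blowDown_one {k : ℕ} (hk1 : 1 ≤ k) (hk : k ≤ (F.P K).m + (F.P K).K) (lo hi : ℕ → Fin (F.P K).d → ℤ)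
    (hlo : ∀ j < k, lo j = fun i => ((F.P K).L : ℤ) * lo (j + 1) i) (hhi : ∀ j < k, hi j = fun i => ((F.P K).L : ℤ) * hi (j + 1) i + (((F.P K).L : ℤ) - 1))
    {a₀ : ℝ} (ha₀ : 0 < a₀) (hta : (((((F.P K).d + 2) * (F.P K).L : ℕ) : ℝ) ^ 2 / 4) * a₀ < deltaSU (Fin N)) :
    ∀ x ∈ (castSite '' Set.Icc (lo 0) (hi 0) : Set (Site (F.P K) 0)), ∀ x' ∈ (castSite '' Set.Icc (lo 0) (hi 0) : Set (Site (F.P K) 0)),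
      dist1 (((fun _ : Site (F.P K) 0 => (1 : SU N)) x)⁻¹ * (fun _ : Site (F.P K) 0 => (1 : SU N)) x') ≤
        2 * ∑ κ, (((((hi 0 κ - lo 0 κ).toNat : ℕ) : ℝ) * ((0 : ℝ) + (7 * ((((((F.P K).d + 2) * (F.P K).L : ℕ) : ℝ) ^ 2 / 4) * a₀) +
          ((((F.P K).d + 1) * ((F.P K).L - 1) : ℕ) : ℝ) * (0 : ℝ))) +
        ∑ i ∈ Finset.range k, ((((hi 0 κ - lo 0 κ).toNat / (F.P K).L ^ (i + 1) + 1 : ℕ)) : ℝ) *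
          (if i + 1 < k then (0 : ℝ) + (7 * ((((((F.P K).d + 2) * (F.P K).L : ℕ) : ℝ) ^ 2 / 4) * a₀) + ((((F.P K).d + 1) * ((F.P K).L - 1) : ℕ) : ℝ) * (0 : ℝ))
            else (0 : ℝ))) + (((hi 0 κ - lo 0 κ).toNat : ℕ) : ℝ) * (0 : ℝ)) := by
  have h1 : gaugeAct (fun _ : Site (F.P K) 0 => (1 : SU N)) (1 : GaugeField (F.P K) 0 (SU N)) = 1 := B12RTGaugeInvariance254.gaugeAct_one' _
  refine fineVariation_le_of_blowDown hk1 hk (fun _ => (1 : SU N)) (1 : GaugeField (F.P K) 0 (SU N)) lo hi hlo hhi (fun _ => a₀) (fun _ => 0)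
    (fun _ _ => ha₀.le) (fun _ _ => le_rfl) le_rfl le_rfl (fun _ _ => hta) (fun i _ c _ _ q _ => ?_) (fun i _ b' _ _ => ?_) (fun c _ _ => ?_) (fun b _ _ => ?_)
  · rw [h1]; exact N07DataDownTheTower.plaq_down_the_tower_one F N K i ha₀ q
  · rw [h1, B15Claim189UnitTestAtRecord.iter_avOfRecord_one F N K i]; exact le_of_eq GaugeGroup.dist1_one
  · rw [h1, B15Claim189UnitTestAtRecord.iter_avOfRecord_one F N K k]; exact le_of_eq GaugeGroup.dist1_one
  · exact le_of_eq GaugeGroup.dist1_one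

end NonVacuity

end Summit.QuantumFields.YangMills.BalabanUVNodes.N07ShearVariationOfTower

end
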